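import Summits.BirchSwinnertonDyer.BirchSwinnertonDyer.Theses.QuadraticBranchSignedControl
import Summits.BirchSwinnertonDyer.Rank1Residual.Additive.QuadraticBranchEvenReadingsOfEta
import HarnessLib

/-!
# Route `QuadraticBranchSignedControl` (rung K8, cell `bsd-potss`): the sign item (R2⁺)
# `NoFiniteSubmodulePlus` (stmt-BirchSwinnertonDyer-19222) from the VERBATIM `η`-component frame of
# Kitajima–Otsuki 2018 Main Thm. 1.3 (sign `+`) — the item typed modulo ONE displayed hypothesis

HONEST FRAMING (cell `bsd-potss`, run/shared/lean/pub/bsd-potss/; FULL-BSD rank ≤ 1 programme,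
tranche 1b): CONDITIONAL RESULT — the hypothesis `hKO` is the cell's verbatim-shape frame of
Kitajima–Otsuki 2018 Main Thm. 1.3 (= Thm. 4.8), sign `+`, read on the `η`-COMPONENT
`X⁺(V/ℚ(μ_{p^∞}))^η` of Kobayashi's plus Selmer dual of the GOOD supersingular twist `V` (cc-typer-6's
`Γ_ℚ`-internal tower object `EtaSignedSelmerDualData V κ K₀ ℚ_[p] η γ 1`, `K₀ = ℚ(μ_p)`; reading flag
`KO18-eta-summand`: the print is for `X⁺(F_∞)` whole, an `η`-part is a direct summand), closed over
`p ≥ 5` exactly as the route's own crux frames (`EtaTransportSigned`) are. It is EXACTLY the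
hypothesis of ctrl's landed discharge
`SignedTwist.evenBranchPlusNoFiniteSubmoduleAt_of_kitajimaOtsuki13PlusEta` (file
`QuadraticBranchEvenReadingsOfEta`, seat `bsd-potss-ctrl` g2), which this file merely closes over
`W`, `p ≥ 5` in the ROUTE's type. NOTHING about the printed theorem is asserted; no definition, no
named Literature fact, no `sorry`, axioms standard; the item is NOT closed by this file (a conditional
theorem closes nothing) — it records in the kernel that item 19222 is the `η`-frame and nothing more:
the TRANSPORT `X⁺(W/ℚ_∞) = X⁺(V/K₀ℚ_∞)^η` (same module, (D5⁺) `exists_etaSignedSelmerDualData_one`)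
is a tree THEOREM, so the "Λ-exactness of the η-transport at the additive prime" of the item's
why-it-might-fail is NOT where a gap sits; what separates `hKO` from print is (a) the `η`-part being a
`Λ`-direct summand of the full dual (`p ∤ #Δ`) and (b) the identification of the `Γ_ℚ`-internal
tower object with the `Γ_{ℚ(μ_p)}`-internal object of the Literature fact
`KitajimaOtsuki2018.mainThm13_plusSelmerDual_noFiniteSubmodule`.

References: [KitajimaOtsuki2018] Main Thm. 1.3 (= Thm. 4.8) with Def. 2.1 (arXiv:1607.03612 pp. 3,
6, 19); [Kobayashi2003] Def. 2.1 and Thm. 2.2 (p. 5), §4 p. 8 (`M^η = ε_η M`).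
-/

set_option autoImplicit false
set_option linter.dupNamespace false

noncomputable section

open scoped Classical

namespace Summit.BirchSwinnertonDyer.BirchSwinnertonDyer.Theorems

open WeierstrassCurve Field Literature.NumberTheory.EllipticCurves
  Literature.NumberTheory.GaloisRepresentations ZpExtension
  Summit.BirchSwinnertonDyer.Rank1Residual.Additive
  Summit.BirchSwinnertonDyer.BirchSwinnertonDyer.Theses.QuadraticBranchSignedControl

/-- **(R2⁺) `NoFiniteSubmodulePlus` (item stmt-BirchSwinnertonDyer-19222) from the verbatim
`η`-component frame of Kitajima–Otsuki 2018 Main Thm. 1.3, sign `+`, for every `p ≥ 5`.** The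
hypothesis `hKO` reads: for `K₀ = ℚ(μ_p)` (any `IsCyclotomicExtension {p} ℚ K₀`), a character `ηq` of
`Γ_ℚ` trivial on `Gal(ℚ̄/K₀)`, a good `a_p = 0` curve `V/ℚ`, the cyclotomic `κ` with a topological
generator `γ ∈ Gal(ℚ̄/K₀)`, and any Pontryagin-dual datum `D` of `Sel⁺(V/K₀ℚ_∞)^η` whose module is
finitely generated `Λ`-torsion: `D.X` has no non-zero finite `Λ`-submodule ("both
`Sel^±(F_∞, E[p^∞])^∨` have no nontrivial finite `Λ`-submodule", `F = ℚ`, read on the `η`-part — flag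
`KO18-eta-summand`). Proof: ctrl's `evenBranchPlusNoFiniteSubmoduleAt_of_kitajimaOtsuki13PlusEta`
at each `W`, `p`. CONDITIONAL on `hKO`; nothing about the printed theorem is asserted; closes nothing.
[cite: KitajimaOtsuki2018, Main Thm. 1.3 (= Thm. 4.8) with Def. 2.1 (arXiv:1607.03612 pp. 3, 6, 19)]
[cite: Kobayashi2003, §4 p. 8 (the η-component) and Def. 2.1 (p. 5)] -/
theorem noFiniteSubmodulePlus_of_kitajimaOtsuki13PlusEta
    (hKO : ∀ (p : ℕ) [Fact p.Prime], 5 ≤ p →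
      ∀ (K₀ : Type) [Field K₀] [NumberField K₀] [IsCyclotomicExtension {p} ℚ K₀]
        [(galRange (K := ℚ) K₀).Normal] (ηq : absoluteGaloisGroup ℚ →* ℤˣ),
        (∀ σ ∈ galRange (K := ℚ) K₀, ηq σ = 1) →
      ∀ (V : WeierstrassCurve ℚ) [V.IsElliptic] [V.IsGloballyMinimal],
        p ≠ 2 → V.HasGoodReductionAtPrime p → V.frobeniusTrace p = 0 →
      ∀ (κ : ZpExtension ℚ p) (γ : absoluteGaloisGroup ℚ),
        κ.IsCyclotomic → κ.IsTopGenerator γ → γ ∈ galRange (K := ℚ) K₀ →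
      ∀ (D : EtaSignedSelmerDualData V κ K₀ ℚ_[p] ηq γ 1),
        Module.Finite (IwasawaAlgebra p) D.X → Module.IsTorsion (IwasawaAlgebra p) D.X →
        ∀ M : Submodule (IwasawaAlgebra p) D.X, Finite M → M = ⊥) :
    NoFiniteSubmodulePlus :=
  fun W _ _ p _ hp5 =>
    SignedTwist.evenBranchPlusNoFiniteSubmoduleAt_of_kitajimaOtsuki13PlusEta W p (hKO p hp5)

end Summit.BirchSwinnertonDyer.BirchSwinnertonDyer.Theorems

end
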